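import Literature.Computability.MetaComplexity.PolynomialCalculusVariableRule
import Literature.Computability.MetaComplexity.PolynomialCalculusMultilinearCompleteness
import Literature.Computability.MetaComplexity.RevResLin
import Summits.PneNP.PneNP.Theorems.ReslinSizeFromWidthQuadraticDictionary
import Summits.PneNP.PneNP.Theorems.ExpanderLinearGeneratorsPolyCalcClauses
import HarnessLib

/-!
# PneNP / ReslinSizeFromWidth — polynomial calculus over `𝔽₂` vs Res(⊕) rank, part 1: the translation

Helper file toward the INPUT side of crux `ResLinSizeFromWidth` (stmt-PneNP-18932): the "indirect
route" by which every Res(⊕) width/rank lower bound before Efremenko–Garlík–Itsykson 2024 was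
obtained — a Res(⊕) refutation of small width is a polynomial calculus refutation over `𝔽₂` of
small degree [Garlík–Kołodziejczyk 2018, proof of Thm 18: "for every inference in P, the polynomial
representing the conclusion can be derived from the polynomials representing the premises in
degree-O(h) Polynomial Calculus"; Gryaznov–Ovcharov–Riazanov 2024, Thm 7 "Deg(φ) ≤ Width(φ)"
(stated without proof, attributed to that proof); Efremenko–Garlík–Itsykson 2024, §1.1.1 "It is
easy to see that a Res(⊕) refutation of width w may be converted to a polynomial calculus (over
𝔽₂) refutation of degree w + O(1)"].  No proof of the simulation is written down in print; this
file and `ReslinSizeFromWidthPCDegree.lean` supply one, for the tree's Res(⊕) (SEMANTIC weakening,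
`IsResLinRefutation`) and Krajíček's PC/F (`PC.DerivableInDegree`), with the basis-free RANK
`linClauseRank` as the width measure and the explicit constant `+1`.

This part: the TRANSLATION of a linear clause into a multilinear polynomial over `𝔽₂` and its
algebra.

* `eq_of_eval_boolPoint_eq` — two multilinear polynomials (`MLPC.ml p = p`) over a field that agree
  on all `0/1` points are equal (evaluation at the indicator point of a monomial of minimal
  support); `eval_boolPoint_ml` — multilinearisation does not change values at `0/1` points.
* `formPoly f = Σ_{i ∈ f} xᵢ`, `litFalsePoly (f, b) = formPoly f + [b]` (value `1` at a Boolean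
  point iff the linear literal `⊕_{i∈f} xᵢ = b` is FALSE there), and the translation of a linear
  clause `C = ⋁ᵢ (fᵢ = aᵢ)`:
  `clausePoly C = ml (∏_{l ∈ C} litFalsePoly l)` — the multilinear indicator of the falsifying
  affine set `¬C` (`eval_boolPoint_clausePoly`: value `0` iff `C` is satisfied).  The empty clause
  goes to `1`, a CNF clause `c` to `ml (unsatPolyK c)` (Krajíček's (6.0.1) translation, reduced).
* Identities forced by the semantics (all via uniqueness): `clausePoly (insert l C) =
  ml (litFalsePoly l · clausePoly C)`; `clausePoly (C ∪ D) = clausePoly D` when `C ⊨ D`;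
  `clausePoly (C ∨ f=0) + clausePoly (C ∨ f=1) = clausePoly C` (the resolution identity).
* DEGREE: `totalDegree (clausePoly C) ≤ linClauseRank C` (`= rk ¬C`).  Proved on a finite window
  `N` of variables with the flats calculus of the quadratic law (`falsN`, `W`, `finrank_W_inter_hyp_eq`):
  adding a literal whose hyperplane contains the falsifying flat does not change the polynomial,
  adding one that cuts it properly raises `dim W` by one and the degree by at most one, adding one
  disjoint from it kills the polynomial.

References: M. Garlík, L. A. Kołodziejczyk, *Some subsystems of constant-depth Frege with parity*,
ACM ToCL 19(4) (2018), §8 (proof of Thm 18); S. Gryaznov, S. Ovcharov, A. Riazanov, *Resolution over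
linear equations: combinatorial games for tree-like size and space*, ACM ToCT (2024),
arXiv:2404.08370, Thm 7; K. Efremenko, M. Garlík, D. Itsykson, *Lower bounds for regular resolution
over parities*, STOC 2024, §1.1.1; J. Krajíček, *Proof Complexity* (2019), §6.2 and (6.0.1).
-/

noncomputable section

namespace Summit.PneNP.PneNP.Theorems

-- `Summit.PneNP.PneNP` repeats a path component by design (summit = sub-problem); silence the linter.
set_option linter.dupNamespace false

namespace ResLinPC

open MvPolynomial Finset Module
open Literature.Computability.Complexity Literature.Computability.MetaComplexity
open Literature.Computability.MetaComplexity.MLPC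
open Literature.Computability.MetaComplexity.AffSys
open Summit.PneNP.PneNP.Theorems.ResLinRank Summit.PneNP.PneNP.Theorems.ResLinSW
open Summit.PneNP.PneNP.Theorems.PolyCalc

/-! ### Multilinear polynomials are determined by their values on the Boolean cube -/

section Multilinear

variable {σ : Type*} {K : Type*} [Field K]

/-- A `0/1` coordinate is idempotent: `bᵉ = b` for `e ≠ 0`. -/
theorem boolPoint_pow (x : σ → Bool) (i : σ) {e : ℕ} (he : e ≠ 0) :
    boolPoint K x i ^ e = boolPoint K x i := by
  unfold boolPoint
  split_ifs
  · exact one_pow e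
  · exact zero_pow he

/-- A product of `0/1` coordinates is the indicator of "all these coordinates are `1`". -/
theorem prod_boolPoint_eq (x : σ → Bool) (S : Finset σ) :
    ∏ i ∈ S, boolPoint K x i = if ∀ i ∈ S, x i = true then 1 else 0 := by
  split_ifs with h
  · exact Finset.prod_eq_one fun i hi => by simp [boolPoint, h i hi]
  · push Not at h
    obtain ⟨i, hi, hx⟩ := h
    exact Finset.prod_eq_zero hi (by simp [boolPoint, hx])

/-- Evaluation of a monomial at a Boolean point only sees the support of the exponent vector. -/
theorem eval_boolPoint_monomial (x : σ → Bool) (s : σ →₀ ℕ) (a : K) :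
    eval (boolPoint K x) (monomial s a) = a * ∏ i ∈ s.support, boolPoint K x i := by
  rw [eval_monomial, Finsupp.prod]
  congr 1
  exact Finset.prod_congr rfl fun i hi => boolPoint_pow x i (Finsupp.mem_support_iff.1 hi)

/-- **Multilinearisation does not change Boolean values**: `(ml p)(x) = p(x)` at every `0/1`
point. -/
theorem eval_boolPoint_ml (x : σ → Bool) (p : MvPolynomial σ K) :
    eval (boolPoint K x) (ml K p) = eval (boolPoint K x) p := by
  classical
  rw [ml_eq_sum, map_sum]
  conv_rhs => rw [p.as_sum, map_sum]
  refine Finset.sum_congr rfl fun s _ => ?_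
  rw [eval_boolPoint_monomial, eval_boolPoint_monomial, support_mlMon]

/-- Multilinear exponent vectors are determined by their supports. -/
theorem eq_of_mlMon_eq_of_support_eq {s t : σ →₀ ℕ} (hs : mlMon s = s) (ht : mlMon t = t)
    (h : s.support = t.support) : s = t := by
  rw [mlMon_eq_self_iff] at hs ht
  ext i
  by_cases hi : i ∈ s.support
  · have hi' : i ∈ t.support := h ▸ hi
    have h1 := Finsupp.mem_support_iff.1 hi
    have h2 := Finsupp.mem_support_iff.1 hi'
    have h3 := hs i
    have h4 := ht i
    omega
  · have hi' : i ∉ t.support := h ▸ hi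
    rw [Finsupp.notMem_support_iff.1 hi, Finsupp.notMem_support_iff.1 hi']

/-- **Uniqueness of multilinear representatives, zero form**: a multilinear polynomial vanishing
at every `0/1` point is zero.  (Evaluate at the indicator point of a monomial of minimal support:
only that monomial survives.) -/
theorem eq_zero_of_eval_boolPoint {p : MvPolynomial σ K} (hp : ml K p = p)
    (h : ∀ x : σ → Bool, eval (boolPoint K x) p = 0) : p = 0 := by
  classical
  by_contra hne
  have hsupp : p.support.Nonempty := by
    rw [Finset.nonempty_iff_ne_empty, Ne, MvPolynomial.support_eq_empty]
    exact hne
  obtain ⟨s, hs, hmin⟩ := p.support.exists_min_image (fun t => t.support.card) hsupp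
  set x : σ → Bool := fun i => decide (i ∈ s.support) with hx
  have hprod : ∀ t : σ →₀ ℕ, ∏ i ∈ t.support, boolPoint K x i ^ t i =
      if t.support ⊆ s.support then 1 else 0 := by
    intro t
    rw [Finset.prod_congr rfl fun i hi => boolPoint_pow x i (Finsupp.mem_support_iff.1 hi),
      prod_boolPoint_eq]
    simp only [hx, decide_eq_true_eq]
    rfl
  have key : eval (boolPoint K x) p = coeff s p := by
    rw [eval_eq, Finset.sum_eq_single s]
    · rw [hprod, if_pos Finset.Subset.rfl, mul_one]
    · intro t ht hts
      rw [hprod]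
      split_ifs with hsub
      · exfalso
        have hne' : t.support ≠ s.support := fun heq =>
          hts (eq_of_mlMon_eq_of_support_eq (mlMon_eq_of_ml_eq_self hp ht)
            (mlMon_eq_of_ml_eq_self hp hs) heq)
        have hlt : t.support.card < s.support.card :=
          Finset.card_lt_card (Finset.ssubset_iff_subset_ne.2 ⟨hsub, hne'⟩)
        exact absurd (hmin t ht) (not_le.2 hlt)
      · rw [mul_zero]
    · intro hs'
      exact absurd hs hs'
  exact (mem_support_iff.1 hs) (key ▸ h x)

/-- **Uniqueness of multilinear representatives**: two multilinear polynomials over a field that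
agree on the Boolean cube are equal. -/
theorem eq_of_eval_boolPoint_eq {p q : MvPolynomial σ K} (hp : ml K p = p) (hq : ml K q = q)
    (h : ∀ x : σ → Bool, eval (boolPoint K x) p = eval (boolPoint K x) q) : p = q := by
  have : p - q = 0 :=
    eq_zero_of_eval_boolPoint (by rw [map_sub, hp, hq]) fun x => by rw [map_sub, h x, sub_self]
  exact sub_eq_zero.1 this

end Multilinear

/-! ### The translation of linear literals and linear clauses over `𝔽₂` -/

/-- The linear form `⊕_{i ∈ f} xᵢ` as a polynomial over `𝔽₂`: `Σ_{i ∈ f} xᵢ`. -/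
def formPoly (f : Finset ℕ) : MvPolynomial ℕ (ZMod 2) :=
  ∑ i ∈ f, X i

/-- The FALSITY polynomial of a linear literal `(f, b)` (the equation `⊕_{i∈f} xᵢ = b`):
`formPoly f + [b]`, equal to `1` at a Boolean point iff the equation fails there. -/
def litFalsePoly (l : LinLit) : MvPolynomial ℕ (ZMod 2) :=
  formPoly l.1 + C (if l.2 = true then 1 else 0)

/-- **The translation of a linear clause** `C = ⋁_{l ∈ C} l`: the multilinear polynomial
`ml (∏_{l ∈ C} litFalsePoly l)`, the indicator of the falsifying affine set `¬C` ("`C` holds"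
is the equation `clausePoly C = 0`). -/
def clausePoly (C : LinClause) : MvPolynomial ℕ (ZMod 2) :=
  ml (ZMod 2) (∏ l ∈ C, litFalsePoly l)

/-- The translation is multilinear. -/
@[simp] theorem ml_clausePoly (C : LinClause) : ml (ZMod 2) (clausePoly C) = clausePoly C :=
  ml_ml _

/-- The empty clause translates to `1`. -/
@[simp] theorem clausePoly_empty : clausePoly (∅ : LinClause) = 1 := by
  rw [clausePoly, Finset.prod_empty, ml_one]

/-- Value of a linear form at a Boolean point: the parity of the number of true variables. -/
theorem eval_boolPoint_formPoly (x : ℕ → Bool) (f : Finset ℕ) :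
    eval (boolPoint (ZMod 2) x) (formPoly f) = ((f.filter fun i => x i = true).card : ZMod 2) := by
  rw [formPoly, map_sum]
  simp only [eval_X, boolPoint]
  rw [Finset.sum_boole]

/-- Value of the falsity polynomial of a literal: `0` if the literal is true, `1` if it is false. -/
theorem eval_boolPoint_litFalsePoly (x : ℕ → Bool) (l : LinLit) :
    eval (boolPoint (ZMod 2) x) (litFalsePoly l) = if l.eval x = true then 0 else 1 := by
  rcases l with ⟨f, b⟩
  rw [litFalsePoly, map_add, eval_C, eval_boolPoint_formPoly]
  by_cases hl : LinLit.eval x (f, b) = true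
  · rw [if_pos hl]
    have hne : (((f.filter fun i => x i = true).card : ℕ) : ZMod 2) ≠ (if b = true then 0 else 1) := by
      intro heq
      have := (linLit_eval_eq_false_iff x f b).2 heq
      rw [hl] at this
      exact Bool.noConfusion this
    rw [zmod2_ne_iff] at hne
    rw [hne]
    cases b <;> simp <;> decide
  · rw [if_neg hl]
    have hfalse : LinLit.eval x (f, b) = false := by simpa using hl
    rw [(linLit_eval_eq_false_iff x f b).1 hfalse]
    cases b <;> simp

/-- **Semantics of the translation**: `clausePoly C` is `0` at a Boolean point satisfying `C` and
`1` at a point falsifying it. -/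
theorem eval_boolPoint_clausePoly (x : ℕ → Bool) (C : LinClause) :
    eval (boolPoint (ZMod 2) x) (clausePoly C) = if C.eval x = true then 0 else 1 := by
  rw [clausePoly, eval_boolPoint_ml, map_prod]
  simp_rw [eval_boolPoint_litFalsePoly]
  by_cases hC : C.eval x = true
  · rw [if_pos hC]
    obtain ⟨l, hl, hlx⟩ : ∃ l ∈ C, l.eval x = true := by
      simpa [LinClause.eval] using hC
    exact Finset.prod_eq_zero hl (by rw [if_pos hlx])
  · rw [if_neg hC]
    refine Finset.prod_eq_one fun l hl => ?_
    have hCf : C.eval x = false := by simpa using hC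
    rw [(LinClause.eval_eq_false_iff x C).1 hCf l hl]
    simp

/-! ### Identities forced by the semantics -/

/-- Adding a literal multiplies by its falsity polynomial (and reduces). -/
theorem clausePoly_insert (l : LinLit) (C : LinClause) :
    clausePoly (insert l C) = ml (ZMod 2) (litFalsePoly l * clausePoly C) := by
  refine eq_of_eval_boolPoint_eq (ml_clausePoly _) (ml_ml _) fun x => ?_
  rw [eval_boolPoint_clausePoly, eval_boolPoint_ml, map_mul, eval_boolPoint_litFalsePoly,
    eval_boolPoint_clausePoly, LinClause.eval_insert]
  cases l.eval x <;> cases C.eval x <;> simp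

/-- **Semantic weakening in the translation**: if `C ⊨ D` then `clausePoly (C ∪ D) = clausePoly D`
(`¬D ⊆ ¬C`, so `¬C ∩ ¬D = ¬D`). -/
theorem clausePoly_union_of_imp {C D : LinClause}
    (h : ∀ σ : ℕ → Bool, C.eval σ = true → D.eval σ = true) :
    clausePoly (C ∪ D) = clausePoly D := by
  refine eq_of_eval_boolPoint_eq (ml_clausePoly _) (ml_clausePoly _) fun x => ?_
  rw [eval_boolPoint_clausePoly, eval_boolPoint_clausePoly, LinClause.eval_union]
  cases hC : C.eval x <;> cases hD : D.eval x <;> simp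
  have := h x hC
  rw [hD] at this
  exact Bool.noConfusion this

/-- **The resolution identity**: `clausePoly (C ∨ f=0) + clausePoly (C ∨ f=1) = clausePoly C`
(the falsifying set of `C` splits along the hyperplane `f = 1` / `f = 0`). -/
theorem clausePoly_insert_false_add_insert_true (f : Finset ℕ) (E : LinClause) :
    clausePoly (insert (f, false) E) + clausePoly (insert (f, true) E) = clausePoly E := by
  refine eq_of_eval_boolPoint_eq (by rw [map_add, ml_clausePoly, ml_clausePoly]) (ml_clausePoly _)
    fun x => ?_
  rw [map_add, eval_boolPoint_clausePoly, eval_boolPoint_clausePoly, eval_boolPoint_clausePoly,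
    LinClause.eval_insert, LinClause.eval_insert, LinLit.eval_true_eq_not]
  cases LinLit.eval x (f, false) <;> cases E.eval x <;> simp

/-- **Initial clauses**: the reduced form of Krajíček's translation `unsatPolyK c` of a CNF clause
is the translation of the clause read as a linear clause. -/
theorem ml_unsatPolyK (c : Clause ℕ) :
    ml (ZMod 2) (unsatPolyK (ZMod 2) c) = clausePoly (Clause.toLinClause c) := by
  refine eq_of_eval_boolPoint_eq (ml_ml _) (ml_clausePoly _) fun x => ?_
  rw [eval_boolPoint_ml, eval_boolPoint_clausePoly, eval_toLinClause]
  exact eval_unsatPolyK x c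

/-! ### Degrees -/

/-- A linear form has degree at most one. -/
theorem totalDegree_formPoly_le (f : Finset ℕ) : (formPoly f).totalDegree ≤ 1 :=
  totalDegree_finsetSum_le fun i _ => (totalDegree_X (R := ZMod 2) i).le

/-- A falsity polynomial of a literal has degree at most one. -/
theorem totalDegree_litFalsePoly_le (l : LinLit) : (litFalsePoly l).totalDegree ≤ 1 :=
  (totalDegree_add _ _).trans
    (max_le (totalDegree_formPoly_le _) (by rw [totalDegree_C]; exact Nat.zero_le _))

/-! ### The translation on a finite window of variables: flats and `dim W` -/

section Window

variable (N : Finset ℕ)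

/-- Dictionary: the vector of `x` lies in the falsifying flat of `C` iff `C` is false at `x`
(forms of `C` inside the window). -/
theorem zOf_mem_falsN_iff {C : LinClause} (hC : ∀ l ∈ C, l.1 ⊆ N) (x : ℕ → Bool) :
    zOf N x ∈ falsN N C ↔ C.eval x = false :=
  zOf_mem_Sol_negSys_iff hC x

/-- Dictionary for one literal: the vector of `x` lies on the hyperplane of `l` iff `l` is false
at `x`. -/
theorem zOf_mem_hyp_eqOf_iff {l : LinLit} (hl : l.1 ⊆ N) (x : ℕ → Bool) :
    zOf N x ∈ hyp (eqOf N l) ↔ l.eval x = false := by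
  have h := zOf_mem_falsN_iff N (C := {l}) (by simpa using hl) x
  rw [← Finset.insert_empty, falsN_insert, falsN_empty, Set.inter_univ, LinClause.eval_insert,
    LinClause.eval_empty, Bool.or_false] at h
  exact h

/-- A clause whose falsifying flat (on a window containing its forms) is empty is a tautology,
and translates to `0`. -/
theorem clausePoly_eq_zero_of_falsN_eq_empty {C : LinClause} (hC : ∀ l ∈ C, l.1 ⊆ N)
    (h : falsN N C = ∅) : clausePoly C = 0 := by
  refine eq_zero_of_eval_boolPoint (ml_clausePoly C) fun x => ?_
  rw [eval_boolPoint_clausePoly]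
  have hx : C.eval x = true := by
    by_contra hx
    have hx' : C.eval x = false := by simpa using hx
    have hmem := (zOf_mem_falsN_iff N hC x).2 hx'
    rw [h] at hmem
    exact hmem
  rw [if_pos hx]

/-- Adding a literal whose hyperplane contains the falsifying flat does not change the
translation. -/
theorem clausePoly_insert_of_subset_hyp {C : LinClause} {l : LinLit} (hC : ∀ l ∈ C, l.1 ⊆ N)
    (hl : l.1 ⊆ N) (h : falsN N C ⊆ hyp (eqOf N l)) :
    clausePoly (insert l C) = clausePoly C := by
  refine eq_of_eval_boolPoint_eq (ml_clausePoly _) (ml_clausePoly _) fun x => ?_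
  rw [eval_boolPoint_clausePoly, eval_boolPoint_clausePoly, LinClause.eval_insert]
  cases hx : C.eval x
  · have hl' : l.eval x = false :=
      (zOf_mem_hyp_eqOf_iff N hl x).1 (h ((zOf_mem_falsN_iff N hC x).2 hx))
    rw [hl']
    rfl
  · simp

/-- **Degree of the translation on a window**: for a non-tautological clause,
`deg (clausePoly C) ≤ dim W (¬C)` (the number of independent equations of its falsifying flat). -/
theorem totalDegree_clausePoly_le_finrank {C : LinClause} (hC : ∀ l ∈ C, l.1 ⊆ N)
    (hne : (falsN N C).Nonempty) :
    (clausePoly C).totalDegree ≤ finrank (ZMod 2) (W (falsN N C)) := by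
  classical
  induction C using Finset.induction_on with
  | empty => simp
  | @insert l C hlC ih =>
    have hC' : ∀ l' ∈ C, l'.1 ⊆ N := fun l' hl' => hC l' (Finset.mem_insert_of_mem hl')
    have hl : l.1 ⊆ N := hC l (Finset.mem_insert_self _ _)
    have hne' : (falsN N C).Nonempty :=
      hne.mono (by rw [falsN_insert]; exact Set.inter_subset_right)
    by_cases hW : eqOf N l ∈ W (falsN N C)
    · rw [clausePoly_insert_of_subset_hyp N hC' hl (mem_W_iff_subset_hyp.1 hW)]
      have hset : falsN N (insert l C) = falsN N C := by
        rw [falsN_insert]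
        exact Set.inter_eq_right.2 (mem_W_iff_subset_hyp.1 hW)
      rw [hset]
      exact ih hC' hne'
    · have hsec : (falsN N C ∩ hyp (eqOf N l)).Nonempty := by
        rwa [Set.inter_comm, ← falsN_insert]
      have hrk := finrank_W_inter_hyp_eq (isFlat_falsN N C) (eqOf N l) hsec hW
      rw [falsN_insert, Set.inter_comm, hrk, clausePoly_insert]
      calc (ml (ZMod 2) (litFalsePoly l * clausePoly C)).totalDegree
          ≤ (litFalsePoly l * clausePoly C).totalDegree := totalDegree_ml_le _
        _ ≤ (litFalsePoly l).totalDegree + (clausePoly C).totalDegree := totalDegree_mul _ _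
        _ ≤ 1 + finrank (ZMod 2) (W (falsN N C)) :=
            add_le_add (totalDegree_litFalsePoly_le l) (ih hC' hne')
        _ = finrank (ZMod 2) (W (falsN N C)) + 1 := add_comm _ _

/-- `dim W (¬C) ≤ rk(¬C) = linClauseRank C` (nonempty falsifying flat). -/
theorem finrank_W_falsN_le_rank {C : LinClause} (hne : (falsN N C).Nonempty) :
    finrank (ZMod 2) (W (falsN N C)) ≤ linClauseRank C :=
  (finrank_W_Sol_le N _ hne).trans (finrank_spanS_negSys_le N C)

/-- `dim W` is anti-monotone on nonempty flats: a smaller flat needs more equations. -/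
theorem finrank_W_mono {S T : Set (↥N → ZMod 2)} (h : S ⊆ T) :
    finrank (ZMod 2) (W T) ≤ finrank (ZMod 2) (W S) :=
  Submodule.finrank_mono (W_anti h)

end Window

/-- **Degree of the translation is at most the rank**: `deg (clausePoly C) ≤ rk(¬C)`. -/
theorem totalDegree_clausePoly_le_rank (C : LinClause) :
    (clausePoly C).totalDegree ≤ linClauseRank C := by
  classical
  set N : Finset ℕ := C.biUnion fun l => l.1 with hN
  have hC : ∀ l ∈ C, l.1 ⊆ N := fun l hl => Finset.subset_biUnion_of_mem (fun l : LinLit => l.1) hl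
  by_cases hne : (falsN N C).Nonempty
  · exact (totalDegree_clausePoly_le_finrank N hC hne).trans (finrank_W_falsN_le_rank N hne)
  · rw [Set.not_nonempty_iff_eq_empty] at hne
    rw [clausePoly_eq_zero_of_falsN_eq_empty N hC hne, totalDegree_zero]
    exact Nat.zero_le _

end ResLinPC

end Summit.PneNP.PneNP.Theorems
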